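import Literature.Probability.LatticeModels.CriticalBlockMoments
import Literature.Probability.LatticeModels.RescaledUrsellUniformOnCompact
import Literature.Probability.LatticeModels.CriticalScalingDimension

/-!
# Block two-point sums at `β_c`: the near/far split with a row-sum bound, and lower bounds on `Σ_L`

Route `LeeYangGap` (Ising3DConformalLimit), support item `GaussianLimitKillsBlockCoupling`
(stmt-CriticalPhenomena-4950), helper file 1/3. Notation: `Λ_L = box d L`,
`G(z) = ⟨σ₀σ_z⟩_{β_c} = criticalTwoPoint d z`, `χ(n) = Σ_{z ∈ Λ_n} G(z)` (written out, no definition),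
`Σ_L = Σ_{a,b ∈ Λ_L} ⟨σ_aσ_b⟩_{β_c}` (`= ⟨M_L²⟩_{β_c}`, `plusExpect_blockSpin_sq_eq_sum`), and the lattice
Ursell function `U₄(a,b,c,e) = ⟨σ_aσ_bσ_cσ_e⟩ - Σ_{pairings} ⟨σσ⟩⟨σσ⟩` written with `criticalCorr d 4/2`.

* `sum_abs_ursellFour_le_of_rowSum` — the near/far split of `Σ_{Λ_L⁴} |U₄|` of
  `PerfectScreeningCoulombImpliesNontrivial.gkb_sum_abs_ursellFour_le_near_add_far`, with the infrared
  row-sum bound replaced by an ABSTRACT row-sum bound `X` (near quadruples: `|U₄| ≤ 2⟨σσ⟩⟨σσ⟩` for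
  the pairing containing the close pair, Aizenman–Duminil-Copin 2021 (3.12); far quadruples: a
  hypothesis `M`): `Σ_{Λ_L⁴}|U₄| ≤ 12 |Λ_L| X Σ_L + |Λ_L|⁴ M`.
* `rowSum_le_boxSum` — the row sums are bounded by `χ(n)`.
* `card_mul_boxSum_le_blockSum` — `|Λ_{L/2}| χ(L/2) ≤ Σ_L` (translation invariance, `G ≥ 0`).
* `card_sq_mul_axis_le_blockSum` (`d = 3`) — `|Λ_{L/2}|² G(2L e₁) ≤ Σ_L` (Messager–Miracle-Solé in
  the averaged sup-norm form `card_box_mul_twoPointPlus_le_sum_box`).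
* `tendsto_renorm_sq_mul_axis_two` (`d = 3`) — `ρ(1/L)² G(2L e₁) → S₂(0, 2e)` for a pointwise
  scaling limit `S` with renormalisation `ρ` (the limit read at the exact lattice pair `(0, 2L e₁)`).

## References

* M. Aizenman, H. Duminil-Copin, Ann. Math. 194 (2021), eq. (3.12) and §5.1 eq. (5.3)
  [AizenmanDuminilCopinAnnals2021].
* M. Aizenman, CDM 2020 (arXiv:2112.04248), §10.1 [AizenmanCDM2020].
-/

noncomputable section

namespace Summit.CriticalPhenomena.Ising3DConformalLimit.LeeYangGapGaussianLimitKillsBlockCoupling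

open Literature.Probability.LatticeModels Filter Set Finset
open scoped Topology BigOperators

/-! ### The near/far split with an abstract row-sum bound -/

/-- **Near/far split of `Σ_{Λ_L⁴} |U₄|` at `β_c` on `ℤ^d`, `d ≥ 3`, with a row-sum bound.** If every
row sum `Σ_{v ∈ Λ_L, ‖v-u‖_∞ ≤ n} ⟨σ_uσ_v⟩_{β_c}` is `≤ X` and `|U₄(a,b,c,e)| ≤ M` for all
`a,b,c,e ∈ Λ_L` at mutual sup-distances `> n`, then
`Σ_{Λ_L⁴} |U₄| ≤ 12 |Λ_L| X Σ_{a,b ∈ Λ_L} ⟨σ_aσ_b⟩_{β_c} + |Λ_L|⁴ M` (near quadruples: `|U₄| ≤ 2⟨σσ⟩⟨σσ⟩`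
for the pairing containing the close pair, `abs_criticalUrsellFour_le_two_mul_pair0k`; far quadruples:
the hypothesis). Adapted from
`PerfectScreeningCoulombImpliesNontrivial.gkb_sum_abs_ursellFour_le_near_add_far`. -/
theorem sum_abs_ursellFour_le_of_rowSum {d : ℕ} (hd : 3 ≤ d) (L n : ℕ) {X M : ℝ} (hM : 0 ≤ M)
    (hrow : ∀ u : Site d,
      ∑ v ∈ (box d L).filter (fun v => Site.supNorm (v - u) ≤ n), criticalCorr d 2 ![u, v] ≤ X)
    (hfar : ∀ a ∈ box d L, ∀ b ∈ box d L, ∀ c ∈ box d L, ∀ e ∈ box d L,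
        n < Site.supNorm (b - a) → n < Site.supNorm (e - c) → n < Site.supNorm (c - a) →
        n < Site.supNorm (e - b) → n < Site.supNorm (e - a) → n < Site.supNorm (c - b) →
        |criticalCorr d 4 ![a, b, c, e] -
          (criticalCorr d 2 ![a, b] * criticalCorr d 2 ![c, e] +
            criticalCorr d 2 ![a, c] * criticalCorr d 2 ![b, e] +
            criticalCorr d 2 ![a, e] * criticalCorr d 2 ![b, c])| ≤ M) :
    ∑ a ∈ box d L, ∑ b ∈ box d L, ∑ c ∈ box d L, ∑ e ∈ box d L,
        |criticalCorr d 4 ![a, b, c, e] -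
          (criticalCorr d 2 ![a, b] * criticalCorr d 2 ![c, e] +
            criticalCorr d 2 ![a, c] * criticalCorr d 2 ![b, e] +
            criticalCorr d 2 ![a, e] * criticalCorr d 2 ![b, c])| ≤
      12 * ((#(box d L) : ℝ) * X) * (∑ a ∈ box d L, ∑ b ∈ box d L, criticalCorr d 2 ![a, b]) +
        (#(box d L) : ℝ) ^ 4 * M := by
  classical
  -- opaque names for the kernels
  obtain ⟨S2, hS2⟩ : ∃ S2 : Site d → Site d → ℝ, ∀ u v, S2 u v = criticalCorr d 2 ![u, v] :=
    ⟨_, fun _ _ => rfl⟩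
  obtain ⟨U, hU⟩ : ∃ U : Site d → Site d → Site d → Site d → ℝ, ∀ a b c e, U a b c e =
      criticalCorr d 4 ![a, b, c, e] -
        (criticalCorr d 2 ![a, b] * criticalCorr d 2 ![c, e] +
          criticalCorr d 2 ![a, c] * criticalCorr d 2 ![b, e] +
          criticalCorr d 2 ![a, e] * criticalCorr d 2 ![b, c]) := ⟨_, fun _ _ _ _ => rfl⟩
  simp only [← hU]
  simp only [← hS2]
  simp only [← hU] at hfar
  simp only [← hS2] at hrow
  set B : Finset (Site d) := box d L with hB
  obtain ⟨I, hI⟩ : ∃ I : Site d → Site d → ℝ, ∀ u v,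
      I u v = if Site.supNorm (v - u) ≤ n then 2 * S2 u v else 0 := ⟨_, fun _ _ => rfl⟩
  obtain ⟨Far, hFar⟩ : ∃ Far : Site d → Site d → Site d → Site d → Prop, ∀ a b c e,
      Far a b c e ↔ (n < Site.supNorm (b - a) ∧ n < Site.supNorm (e - c) ∧
        n < Site.supNorm (c - a) ∧ n < Site.supNorm (e - b) ∧ n < Site.supNorm (e - a) ∧
        n < Site.supNorm (c - b)) := ⟨_, fun _ _ _ _ => Iff.rfl⟩
  -- the three pointwise bounds and non-negativity
  have hS2nn : ∀ u v, 0 ≤ S2 u v := fun u v => by rw [hS2]; exact criticalCorr_two_nonneg u v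
  have hInn : ∀ u v, 0 ≤ I u v := fun u v => by
    rw [hI]; split_ifs; exacts [mul_nonneg two_pos.le (hS2nn u v), le_rfl]
  have hP1 : ∀ a b c e, |U a b c e| ≤ 2 * S2 a b * S2 c e := fun a b c e => by
    rw [hU, hS2, hS2]; exact abs_criticalUrsellFour_le_two_mul_pair01 hd a b c e
  have hP2 : ∀ a b c e, |U a b c e| ≤ 2 * S2 a c * S2 b e := fun a b c e => by
    rw [hU, hS2, hS2]; exact abs_criticalUrsellFour_le_two_mul_pair02 hd a b c e
  have hP3 : ∀ a b c e, |U a b c e| ≤ 2 * S2 a e * S2 b c := fun a b c e => by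
    rw [hU, hS2, hS2]; exact abs_criticalUrsellFour_le_two_mul_pair03 hd a b c e
  -- pointwise domination by the seven majorants
  have hpt : ∀ a ∈ B, ∀ b ∈ B, ∀ c ∈ B, ∀ e ∈ B, |U a b c e| ≤
      I a b * S2 c e + S2 a b * I c e + I a c * S2 b e + S2 a c * I b e +
        I a e * S2 b c + S2 a e * I b c + (if Far a b c e then M else 0) := by
    intro a ha b hb c hc e he
    have n1 : 0 ≤ I a b * S2 c e := mul_nonneg (hInn a b) (hS2nn c e)
    have n2 : 0 ≤ S2 a b * I c e := mul_nonneg (hS2nn a b) (hInn c e)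
    have n3 : 0 ≤ I a c * S2 b e := mul_nonneg (hInn a c) (hS2nn b e)
    have n4 : 0 ≤ S2 a c * I b e := mul_nonneg (hS2nn a c) (hInn b e)
    have n5 : 0 ≤ I a e * S2 b c := mul_nonneg (hInn a e) (hS2nn b c)
    have n6 : 0 ≤ S2 a e * I b c := mul_nonneg (hS2nn a e) (hInn b c)
    have n7 : 0 ≤ (if Far a b c e then M else 0) := by split_ifs <;> linarith
    by_cases h1 : Site.supNorm (b - a) ≤ n
    · have e1 : I a b * S2 c e = 2 * S2 a b * S2 c e := by rw [hI, if_pos h1]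
      linarith [hP1 a b c e]
    by_cases h2 : Site.supNorm (e - c) ≤ n
    · have e2 : S2 a b * I c e = 2 * S2 a b * S2 c e := by rw [hI, if_pos h2]; ring
      linarith [hP1 a b c e]
    by_cases h3 : Site.supNorm (c - a) ≤ n
    · have e3 : I a c * S2 b e = 2 * S2 a c * S2 b e := by rw [hI, if_pos h3]
      linarith [hP2 a b c e]
    by_cases h4 : Site.supNorm (e - b) ≤ n
    · have e4 : S2 a c * I b e = 2 * S2 a c * S2 b e := by rw [hI, if_pos h4]; ring
      linarith [hP2 a b c e]
    by_cases h5 : Site.supNorm (e - a) ≤ n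
    · have e5 : I a e * S2 b c = 2 * S2 a e * S2 b c := by rw [hI, if_pos h5]
      linarith [hP3 a b c e]
    by_cases h6 : Site.supNorm (c - b) ≤ n
    · have e6 : S2 a e * I b c = 2 * S2 a e * S2 b c := by rw [hI, if_pos h6]; ring
      linarith [hP3 a b c e]
    have hF : Far a b c e := (hFar a b c e).2
      ⟨not_le.1 h1, not_le.1 h2, not_le.1 h3, not_le.1 h4, not_le.1 h5, not_le.1 h6⟩
    have e7 : (if Far a b c e then M else 0) = M := if_pos hF
    have hM' := hfar a ha b hb c hc e he (not_le.1 h1) (not_le.1 h2) (not_le.1 h3) (not_le.1 h4)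
      (not_le.1 h5) (not_le.1 h6)
    linarith
  -- the row sums of the near kernel
  have hrow' : ∀ u, ∑ v ∈ B, I u v ≤ 2 * X := by
    intro u
    simp only [hI]
    rw [← Finset.sum_filter, ← Finset.mul_sum]
    exact mul_le_mul_of_nonneg_left (hrow u) two_pos.le
  have hIIle : ∑ u ∈ B, ∑ v ∈ B, I u v ≤ (#B : ℝ) * (2 * X) := by
    calc ∑ u ∈ B, ∑ v ∈ B, I u v ≤ ∑ _u ∈ B, 2 * X := Finset.sum_le_sum fun u _ => hrow' u
      _ = (#B : ℝ) * (2 * X) := by rw [Finset.sum_const, nsmul_eq_mul]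
  have hXS : (∑ u ∈ B, ∑ v ∈ B, I u v) * (∑ a ∈ B, ∑ b ∈ B, S2 a b) ≤
      (#B : ℝ) * (2 * X) * (∑ a ∈ B, ∑ b ∈ B, S2 a b) := mul_le_mul_of_nonneg_right hIIle
    (Finset.sum_nonneg fun a _ => Finset.sum_nonneg fun b _ => hS2nn a b)
  -- the far majorant
  have h7 : ∑ a ∈ B, ∑ b ∈ B, ∑ c ∈ B, ∑ e ∈ B, (if Far a b c e then M else 0) ≤
      (#B : ℝ) ^ 4 * M := by
    calc ∑ a ∈ B, ∑ b ∈ B, ∑ c ∈ B, ∑ e ∈ B, (if Far a b c e then M else 0)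
        ≤ ∑ _a ∈ B, ∑ _b ∈ B, ∑ _c ∈ B, ∑ _e ∈ B, M :=
          Finset.sum_le_sum fun a _ => Finset.sum_le_sum fun b _ => Finset.sum_le_sum fun c _ =>
            Finset.sum_le_sum fun e _ => by split_ifs <;> linarith
      _ = (#B : ℝ) ^ 4 * M := by simp only [Finset.sum_const, nsmul_eq_mul]; ring
  -- summation
  calc ∑ a ∈ B, ∑ b ∈ B, ∑ c ∈ B, ∑ e ∈ B, |U a b c e|
      ≤ ∑ a ∈ B, ∑ b ∈ B, ∑ c ∈ B, ∑ e ∈ B,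
          (I a b * S2 c e + S2 a b * I c e + I a c * S2 b e + S2 a c * I b e +
            I a e * S2 b c + S2 a e * I b c + (if Far a b c e then M else 0)) :=
        Finset.sum_le_sum fun a ha => Finset.sum_le_sum fun b hb => Finset.sum_le_sum fun c hc =>
          Finset.sum_le_sum fun e he => hpt a ha b hb c hc e he
    _ = (∑ u ∈ B, ∑ v ∈ B, I u v) * (∑ a ∈ B, ∑ b ∈ B, S2 a b) +
          (∑ a ∈ B, ∑ b ∈ B, S2 a b) * (∑ u ∈ B, ∑ v ∈ B, I u v) +
          (∑ u ∈ B, ∑ v ∈ B, I u v) * (∑ a ∈ B, ∑ b ∈ B, S2 a b) +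
          (∑ a ∈ B, ∑ b ∈ B, S2 a b) * (∑ u ∈ B, ∑ v ∈ B, I u v) +
          (∑ u ∈ B, ∑ v ∈ B, I u v) * (∑ a ∈ B, ∑ b ∈ B, S2 a b) +
          (∑ a ∈ B, ∑ b ∈ B, S2 a b) * (∑ u ∈ B, ∑ v ∈ B, I u v) +
          ∑ a ∈ B, ∑ b ∈ B, ∑ c ∈ B, ∑ e ∈ B, (if Far a b c e then M else 0) := by
        simp only [Finset.sum_add_distrib]
        rw [sum_sum_sum_sum_mul_pair01 B I S2, sum_sum_sum_sum_mul_pair01 B S2 I,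
          sum_sum_sum_sum_mul_pair02 B I S2, sum_sum_sum_sum_mul_pair02 B S2 I,
          sum_sum_sum_sum_mul_pair03 B I S2, sum_sum_sum_sum_mul_pair03 B S2 I]
    _ ≤ 12 * ((#B : ℝ) * X) * (∑ a ∈ B, ∑ b ∈ B, S2 a b) + (#B : ℝ) ^ 4 * M := by
        nlinarith [hXS, h7]

/-! ### Row sums and the box two-point sum `χ(n) = Σ_{z ∈ Λ_n} ⟨σ₀σ_z⟩_{β_c}` -/

/-- **Row sums are bounded by `χ(n)`**: for every `u` and every `n`,
`Σ_{v ∈ Λ_L, ‖v-u‖_∞ ≤ n} ⟨σ_uσ_v⟩_{β_c} ≤ Σ_{z ∈ Λ_n} ⟨σ₀σ_z⟩_{β_c}` (translation invariance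
`⟨σ_uσ_v⟩ = ⟨σ₀σ_{v-u}⟩`, `criticalCorr_two_pair`, the injection `v ↦ v - u` into `Λ_n`, and
`⟨σ₀σ_z⟩ ≥ 0`). -/
theorem rowSum_le_boxSum {d : ℕ} (L n : ℕ) (u : Site d) :
    ∑ v ∈ (box d L).filter (fun v => Site.supNorm (v - u) ≤ n), criticalCorr d 2 ![u, v] ≤
      ∑ z ∈ box d n, criticalTwoPoint d z := by
  classical
  set s := (box d L).filter (fun v => Site.supNorm (v - u) ≤ n) with hs
  have h1 : ∑ v ∈ s, criticalCorr d 2 ![u, v] = ∑ z ∈ s.image (· - u), criticalTwoPoint d z := by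
    rw [Finset.sum_image (fun v _ w _ h => sub_left_injective h)]
    exact Finset.sum_congr rfl fun v _ => criticalCorr_two_pair u v
  have h2 : s.image (· - u) ⊆ box d n := by
    intro z hz
    obtain ⟨v, hv, rfl⟩ := Finset.mem_image.1 hz
    exact mem_box_iff_supNorm_le.2 (Finset.mem_filter.1 hv).2
  rw [h1]
  exact Finset.sum_le_sum_of_subset_of_nonneg h2 fun z _ _ => criticalTwoPoint_nonneg' z

/-- `χ` is monotone: `Σ_{Λ_m} ⟨σ₀σ_z⟩_{β_c} ≤ Σ_{Λ_n} ⟨σ₀σ_z⟩_{β_c}` for `m ≤ n` (`Λ_m ⊆ Λ_n`, `⟨σ₀σ_z⟩ ≥ 0`). -/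
theorem boxSum_mono {d : ℕ} {m n : ℕ} (h : m ≤ n) :
    ∑ z ∈ box d m, criticalTwoPoint d z ≤ ∑ z ∈ box d n, criticalTwoPoint d z :=
  Finset.sum_le_sum_of_subset_of_nonneg (box_mono d h) fun z _ _ => criticalTwoPoint_nonneg' z

/-- `0 ≤ χ(n)`. -/
theorem boxSum_nonneg {d : ℕ} (n : ℕ) : 0 ≤ ∑ z ∈ box d n, criticalTwoPoint d z :=
  Finset.sum_nonneg fun z _ => criticalTwoPoint_nonneg' z

/-- `1 ≤ χ(n)` (the term `z = 0` is `⟨σ₀σ₀⟩ = 1`). -/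
theorem one_le_boxSum {d : ℕ} (n : ℕ) : 1 ≤ ∑ z ∈ box d n, criticalTwoPoint d z := by
  classical
  have h := Finset.single_le_sum (f := fun z => criticalTwoPoint d z)
    (fun z _ => criticalTwoPoint_nonneg' z) (zero_mem_box d n)
  rwa [criticalTwoPoint_zero'] at h

/-! ### Lower bounds on the block two-point sum `Σ_L` -/

/-- **`|Λ_{L/2}| χ(L/2) ≤ Σ_L`**: for `a ∈ Λ_{L/2}` the translate `a + Λ_{L/2}` lies in `Λ_L`, so the
row `Σ_{b ∈ Λ_L} ⟨σ_aσ_b⟩_{β_c}` dominates `Σ_{z ∈ Λ_{L/2}} ⟨σ₀σ_z⟩_{β_c}` (translation invariance and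
`⟨σσ⟩ ≥ 0`). -/
theorem card_mul_boxSum_le_blockSum {d : ℕ} (L : ℕ) :
    (#(box d (L / 2)) : ℝ) * ∑ z ∈ box d (L / 2), criticalTwoPoint d z ≤
      ∑ a ∈ box d L, ∑ b ∈ box d L, criticalCorr d 2 ![a, b] := by
  classical
  set L2 := L / 2 with hL2
  have hsub : box d L2 ⊆ box d L := box_mono d (Nat.div_le_self L 2)
  have hLL : (L2 : ℤ) + L2 ≤ L := by
    have h : L2 + L2 ≤ L := by omega
    exact_mod_cast h
  have hinner : ∀ a ∈ box d L2,
      ∑ z ∈ box d L2, criticalTwoPoint d z ≤ ∑ b ∈ box d L, criticalCorr d 2 ![a, b] := by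
    intro a ha
    have himg : (box d L2).image (fun z => a + z) ⊆ box d L := by
      intro b hb
      obtain ⟨z, hz, rfl⟩ := Finset.mem_image.1 hb
      rw [mem_box] at ha hz ⊢
      intro i
      have h1 := ha i
      have h2 := hz i
      simp only [Pi.add_apply]
      constructor <;> omega
    have e1 : ∑ z ∈ box d L2, criticalTwoPoint d z =
        ∑ b ∈ (box d L2).image (fun z => a + z), criticalCorr d 2 ![a, b] := by
      rw [Finset.sum_image (fun z _ w _ h => add_left_cancel h)]
      refine Finset.sum_congr rfl fun z _ => ?_
      rw [criticalCorr_two_pair, add_sub_cancel_left]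
    rw [e1]
    exact Finset.sum_le_sum_of_subset_of_nonneg himg fun b _ _ => criticalCorr_two_nonneg a b
  calc (#(box d L2) : ℝ) * ∑ z ∈ box d L2, criticalTwoPoint d z
      = ∑ _a ∈ box d L2, ∑ z ∈ box d L2, criticalTwoPoint d z := by
        rw [Finset.sum_const, nsmul_eq_mul]
    _ ≤ ∑ a ∈ box d L2, ∑ b ∈ box d L, criticalCorr d 2 ![a, b] :=
        Finset.sum_le_sum fun a ha => hinner a ha
    _ ≤ ∑ a ∈ box d L, ∑ b ∈ box d L, criticalCorr d 2 ![a, b] :=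
        Finset.sum_le_sum_of_subset_of_nonneg hsub fun a _ _ =>
          Finset.sum_nonneg fun b _ => criticalCorr_two_nonneg a b

/-- **`|Λ_{L/2}| ⟨σ₀σ_{2L e₁}⟩_{β_c} ≤ χ(L/2)` on `ℤ³`**: the Messager–Miracle-Solé comparison in the
averaged sup-norm form of Aizenman–Duminil-Copin 2021 (`card_box_mul_twoPointPlus_le_sum_box`, with
`3 · (L/2) ≤ 2L ≤ ‖2L e₁‖_∞`). [cite: AizenmanDuminilCopinAnnals2021, arXiv:1912.07973 §5.3, display after the proof of Thm 5.6 (p. 19), first inequality] -/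
theorem card_mul_axis_le_boxSum (L : ℕ) :
    (#(box 3 (L / 2)) : ℝ) * criticalTwoPoint 3 (Pi.single 0 ((2 * L : ℕ) : ℤ)) ≤
      ∑ z ∈ box 3 (L / 2), criticalTwoPoint 3 z := by
  have h : 3 * (L / 2) ≤ Site.supNorm (Pi.single (0 : Fin 3) ((2 * L : ℕ) : ℤ) : Site 3) := by
    have h1 := Site.natAbs_le_supNorm (Pi.single (0 : Fin 3) ((2 * L : ℕ) : ℤ) : Site 3) 0
    simp only [Pi.single_eq_same, Int.natAbs_natCast] at h1
    omega
  exact card_box_mul_twoPointPlus_le_sum_box (criticalBeta_nonneg 3) h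

/-- **`|Λ_{L/2}|² ⟨σ₀σ_{2L e₁}⟩_{β_c} ≤ Σ_L` on `ℤ³`** (the two previous bounds). -/
theorem card_sq_mul_axis_le_blockSum (L : ℕ) :
    (#(box 3 (L / 2)) : ℝ) ^ 2 * criticalTwoPoint 3 (Pi.single 0 ((2 * L : ℕ) : ℤ)) ≤
      ∑ a ∈ box 3 L, ∑ b ∈ box 3 L, criticalCorr 3 2 ![a, b] := by
  calc (#(box 3 (L / 2)) : ℝ) ^ 2 * criticalTwoPoint 3 (Pi.single 0 ((2 * L : ℕ) : ℤ))
      = (#(box 3 (L / 2)) : ℝ) *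
          ((#(box 3 (L / 2)) : ℝ) * criticalTwoPoint 3 (Pi.single 0 ((2 * L : ℕ) : ℤ))) := by ring
    _ ≤ (#(box 3 (L / 2)) : ℝ) * ∑ z ∈ box 3 (L / 2), criticalTwoPoint 3 z :=
        mul_le_mul_of_nonneg_left (card_mul_axis_le_boxSum L) (Nat.cast_nonneg _)
    _ ≤ _ := card_mul_boxSum_le_blockSum L

/-- `L³ ≤ |Λ_{L/2}|` (`|Λ_m| = (2m+1)³` and `2(L/2) + 1 ≥ L`). -/
theorem pow_three_le_card_box_half (L : ℕ) : (L : ℝ) ^ 3 ≤ (#(box 3 (L / 2)) : ℝ) := by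
  rw [card_box]
  have h : L ≤ 2 * (L / 2) + 1 := by omega
  exact_mod_cast Nat.pow_le_pow_left h 3

/-- `|Λ_L| ≤ 27 L³` for `L ≥ 1`. -/
theorem card_box_le (L : ℕ) (hL : 1 ≤ L) : (#(box 3 L) : ℝ) ≤ 27 * (L : ℝ) ^ 3 := by
  rw [card_box]
  push_cast
  have hLr : (1 : ℝ) ≤ L := by exact_mod_cast hL
  calc (2 * (L : ℝ) + 1) ^ 3 ≤ (3 * L) ^ 3 := pow_le_pow_left₀ (by positivity) (by linarith) 3
    _ = 27 * (L : ℝ) ^ 3 := by ring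

/-! ### The scaling limit at the exact lattice pair `(0, 2L e₁)` -/

/-- At mesh `1/L` the pair `(0, 2e)` of `ℝ³` sits exactly on the lattice pair `(0, 2L e₁)`. -/
theorem latticeApprox_inv_natCast_two (L : ℕ) (hL : 0 < L) :
    (fun i => latticeApprox (1 / (L : ℝ))
        ((![0, EuclideanSpace.single (0 : Fin 3) ((2 : ℕ) : ℝ)] :
          Fin 2 → EuclideanSpace ℝ (Fin 3)) i)) =
      ![(0 : Site 3), Pi.single 0 ((2 * L : ℕ) : ℤ)] := by
  have hL' : (0 : ℝ) < L := by exact_mod_cast hL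
  funext i j
  fin_cases i
  · simp [latticeApprox_apply]
  · simp only [latticeApprox_apply, Fin.mk_one, Matrix.cons_val_one, Matrix.cons_val_zero,
      PiLp.single_apply, Pi.single_apply]
    by_cases hj : j = 0
    · subst hj
      simp only [if_true]
      rw [show (((2 : ℕ) : ℝ)) / (1 / (L : ℝ)) = (((2 * L : ℕ) : ℤ) : ℝ) by push_cast; field_simp]
      exact Int.floor_intCast _
    · simp [hj]

/-- **`ρ(1/L)² ⟨σ₀σ_{2L e₁}⟩_{β_c} → S₂(0, 2e)`** along the integer meshes `δ = 1/L`, for a pointwise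
scaling limit `S` of `criticalCorr 3` with renormalisation `ρ`. -/
theorem tendsto_renorm_sq_mul_axis_two {ρ : ℝ → ℝ} {S : CorrFamily 3}
    (hlim : HasPointwiseScalingLimit (criticalCorr 3) ρ S) :
    Tendsto (fun L : ℕ => ρ (1 / (L : ℝ)) ^ 2 * criticalTwoPoint 3 (Pi.single 0 ((2 * L : ℕ) : ℤ)))
      atTop (𝓝 (S 2 ![0, EuclideanSpace.single (0 : Fin 3) ((2 : ℕ) : ℝ)])) := by
  have hδ : Tendsto (fun L : ℕ => (1 : ℝ) / L) atTop (𝓝[>] (0 : ℝ)) := by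
    refine tendsto_nhdsWithin_iff.2 ⟨tendsto_one_div_atTop_nhds_zero_nat, ?_⟩
    filter_upwards [eventually_ge_atTop 1] with L hL
    have hL' : (0 : ℝ) < L := Nat.cast_pos.2 hL
    exact one_div_pos.2 hL'
  have hx₀ := zero_unitVec_mem_nonCoincident (t := ((2 : ℕ) : ℝ)) (by norm_num)
  have h1 := ((hlim 2).tendsto_at hx₀).comp hδ
  refine h1.congr' ?_
  filter_upwards [eventually_ge_atTop 1] with L hL
  simp only [Function.comp_apply, rescaledCorrelator_apply]
  rw [latticeApprox_inv_natCast_two L hL, criticalCorr_two]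

end Summit.CriticalPhenomena.Ising3DConformalLimit.LeeYangGapGaussianLimitKillsBlockCoupling

end
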